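import Literature.MathematicalPhysics.QuantumFieldTheory.Balaban1983to89.B13CoerciveAlongPencilLocated

/-!
# `Balaban1983to89.B13CoerciveAlongPencilReg335Located` — T. Bałaban, *Propagators for lattice gauge theories in a background field*, Commun. Math. Phys. **99** (1985)
# 389–434 [Balaban1985BackgroundPropagators], (3.19)–(3.27) pp. 393–395, (3.34)–(3.35) p. 396, Thm 3.1 (3.42) p. 397, Thm 3.2 (3.48) p. 398, (3.46)–(3.47) p. 398, Thm 3.3
# p. 399, Thm 3.4 and (3.50) p. 400, (3.62)–(3.64) p. 402, (3.84) p. 407, Thm 3.10 (3.107)–(3.108) pp. 415–416, Thm 3.11 p. 416; [Balaban1984PropagatorsII] (2.19), p. 226,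
# Lemma 2.1 (2.61) p. 234; [Balaban1988RG2Cluster] (2.5)–(2.7) pp. 12–13, p. 15: ★★★★ THEOREM 3.11's CLAUSE IS OPEN ALONG pv27's PENCIL AROUND EVERY COERCIVE MEMBER OF THE
# REGULAR CLASS (3.35), WITH A LOCATED RADIUS — the lane's module 83 on (3.35) at the readings of record: Δ_a's pencil letters come from the end-to-end located v4 road
# `G′ (dag-n10-w6) → X⁻¹ (dag-n10-w5) → R (dag-n10-w2) → Δ_a (this seat)`, the ONLY displayed analytic sentence being the centre's coercivity (or print's two statements).

THE DISPLAY.  For every background `U₀ ∈ (bg9K (M_N ℂ) G i).Reg335 c α₀` (`G ≤ U(N)`, `0 ≤ c·M·α₀`, `c·M·α₀·(d+1) ≤ 1∕16`): the (3.35) data, `η`, `0 < Rc`, the G′ rate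
window `0 ≤ ρ′ < δ₀∕((d+1)L^k)`, dag-n10-w5's X⁻¹ window `(μ_X, κ_X, hκm_X, ρ″)`, the R-station's loss `0 < μ`, `2μ < ρ″`, ONE dominating constant `B′` for the assembled Δ_a
letters stated ONCE as `hBΔ : ∀ R, 0 < R → R ≤ Rc → N(R) ≤ B′` (`N(R)` a NUMBER in `(d, L, k, N, c_f, b₁, η, R, ρ″, μ)` — the binder block of this seat's
`B13GreenStationCoerciveLocated` §2 byte-for-byte), and the centre's flat coercivity `m·⟨Ψ,Ψ⟩₁ ≤ ⟨Ψ, Δ_a(U₀)Ψ⟩₁` (Theorem 3.11 ∕ [4] p.226 quantitatively — N06's) or,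
by the lane's module 82, Theorem 3.11's clause `hpd` + Theorem 3.3's (3.46)–(3.47) form bound `hGB` (`m = B⁻¹`).  The R-station's output at some radius `0 < R₁ ≤ R₁⋆` is
dag-n10-w2 g4's `B13OpsYPencilRProjSymLocated.…_of_reg335_located_of_xinvLocated`; the rest is `B13CoerciveAlongPencilLocated` §2 at `Rd := R₁`.

[folklore] one `obtain` + positional applications of cited tree theorems + (the clean member) ten lines of real arithmetic; kernel-checked; THEOREMS ONLY (no `def`, no
`structure`, no instance, no notation; `open scoped Matrix.Norms.L2Operator` = the record's norm); NOTHING of NODE 00's ∕ pv27's ∕ the lane's ∕ dag-n10-w2's ∕ dag-n10-w5's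
∕ dag-n10-w6's ∕ n06-j's files is modified; nothing here is a claim about the Yang–Mills mass gap; no node is discharged; count-neutral.

WHY THIS FILE (cell `pub-ymgap`, HUMAN RULING D-0062 ∕ D-0149, Track A node N10 = [B13]; WIDTH SEAT `pub-ymgap-dag-n10-w4` g6, CLAIM-4 (R455 (A)); the (3.35) face of
module 83, sibling of the lane owner's census v21 items 1 and 3: the N06 certificate's row 17 displays Theorem 3.11's clause per member of (3.35), and the lane's modules
82–84 reduce the last inverse to that clause + Theorem 3.3 AT ONE BACKGROUND PER PENCIL — this file records, with located constants, that ONE coercive member carries the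
clause to a whole located chart ball (and its gauge orbit) around it).  WHICH reading the N10 term of record uses is NODE 00's ∕ def-T's word — NOT claimed here.

WHAT THIS FILE PROVES (all `theorem`s; `c_V = (d+1)N²c₀(1,ρ″−2μ)^{d+1}`).
* ★★★★ `exists_trIP_deltaAY_recordV4_prodCfg_ge_ballFamily_of_reg335_of_coer_centre_located` — `∃ R₁, 0 < R₁ ∧ R₁ ≤ R₁⋆ ∧ ∀ R′ ≤ R₁, ∀ ‖A′‖ < R′, ∀ Ψ,
  (m − 2(B′c_V)R′∕R₁)⟨Ψ,Ψ⟩₁ ≤ ⟨Ψ, Δ_a(e^{iηA′}U₀)Ψ⟩₁` (the whole ball family behind the hidden radius).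
* ★★★★ `exists_ball_posDefTr_deltaAY_recordV4_prodCfg_of_reg335_of_coer_centre_located` — with `0 < m`: `∃ R₁, 0 < R₁ ∧ R₁ ≤ R₁⋆ ∧ ∀ ‖A′‖ < R₁·m∕(m + 2B′c_V),
  PosDefTr 1 (Δ_a(e^{iηA′}U₀))` (the clean member; radius a fixed fraction of the R-station's radius) · ★★★★ `exists_ball_posDefTr_deltaAY_gaugeY_recordV4_prodCfg_of_reg335_of_coer_centre_located`
  (on the gauge orbit of that ball, (3.34)) · ★★★★ `exists_ball_posDefTr_deltaAY_recordV4_prodCfg_of_reg335_of_posDefTr_of_GAY_formBound_located` (centre from `hpd + hGB`, `m = B⁻¹`).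
HONEST FRAMING: located instances; finite-lattice constants, NOT print's `O(1)`; Theorems 3.1 ∕ 3.2 enter through dag-n10-w6's ∕ dag-n10-w5's ∕ dag-n10-w2's located stations
(tree theorems on (3.35)), while the centre's coercivity `hco`, resp. Theorem 3.11's clause `hpd` and Theorem 3.3's (3.46)–(3.47) form bound `hGB`, stay DISPLAYED (N06's, NOT in
the tree on (3.35)); the clause is therefore NOT proved for any member of (3.35) here — only TRANSPORTED from a member to a located chart ball around it; the balls are in the
CHART; nothing of Bałaban's asserted; N06 ∕ N10 NOT discharged; K1⁹ stmt-QuantumFields-27364 OPEN, no registered stub proved; counts unmoved (typed 28∕28 · discharged 5∕27);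
0 `def`, 0 `sorry`, standard axioms; one finite 𝕋⁴ programme at fixed ε, Bałaban AS PRINTED — R4 closes the conditional finite-𝕋⁴ rung `BalabanLadder.UV` only; the YM mass gap
(Clay) is NOT proved by any of this; nothing continuum ∕ ℝ⁴ ∕ OS.  Filed `--kind proof --supports stmt-QuantumFields-27364`, Literature lane.

References: T. Bałaban, CMP 99 (1985) 389–434 [Balaban1985BackgroundPropagators] (3.19)–(3.27) pp.393–395, (3.34)–(3.35) p.396, Thm 3.1 (3.42) p.397, Thm 3.2 (3.48)
p.398, (3.46)–(3.47) p.398, Thm 3.3 p.399, Thm 3.4 and (3.50) p.400, (3.62)–(3.64) p.402, (3.84) p.407, Thm 3.10 (3.107)–(3.108) pp.415–416, Thm 3.11 p.416; CMP 96 (1984)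
223–250 [Balaban1984PropagatorsII] (2.19), p.226, Lemma 2.1 (2.61) p.234; CMP 116 (1988) 1–22 [Balaban1988RG2Cluster] (2.5)–(2.7) pp.12–13, p.15.
-/

noncomputable section

namespace Literature.MathematicalPhysics.QuantumFieldTheory.Balaban1983to89.B13CoerciveAlongPencilReg335Located

open Metric Finset Module
open scoped Matrix Matrix.Norms.L2Operator
open Literature.MathematicalPhysics.QuantumFieldTheory.Balaban1983to89
open Literature.MathematicalPhysics.QuantumFieldTheory.Balaban1983to89.B9Thm37GlueTorus (tdist1)
open Literature.MathematicalPhysics.QuantumFieldTheory.Balaban1983to89.B5TorusCover (UT)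
open Literature.MathematicalPhysics.QuantumFieldTheory.Balaban1983to89.B9Thm311ReadingCoords (trIP PosDefTr)
open Literature.MathematicalPhysics.QuantumFieldTheory.Balaban1983to89.B13EntrywiseWalks (RawEntryLetters)
open Literature.MathematicalPhysics.QuantumFieldTheory.Balaban1983to89.B9Eq39Adjoint (prodCfg)
open Literature.MathematicalPhysics.QuantumFieldTheory.Balaban1983to89.B6GlobalChartV1 (PV)
open Literature.MathematicalPhysics.QuantumFieldTheory.Balaban1983to89.B6KLevelCensusIndexV1 (KIdx kGeo)
open Literature.MathematicalPhysics.QuantumFieldTheory.Balaban1983to89.B9BackgroundsKLevelV1 (bg9K)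
open Literature.MathematicalPhysics.QuantumFieldTheory.Balaban1983to89.Node00 (SiteY FBondY CfgY GaugeY gaugeY RY deltaAY GAY parBY parSymY GpY toKT)
open Literature.MathematicalPhysics.QuantumFieldTheory.Balaban1983to89.B13CoerciveOfInverseFormBound (trIP_deltaAY_parSymY_ge_of_posDefTr_of_GAY_formBound)
open Literature.MathematicalPhysics.QuantumFieldTheory.Balaban1983to89.B13InverseLettersOnCoerciveBallLocated (rawEntryLetters_toMatrix_deltaAY_parBY_prodCfg_of_pencil_located)
open Literature.MathematicalPhysics.QuantumFieldTheory.Balaban1983to89.B13CoerciveAlongPencilLocated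
  (trIP_deltaAY_parBY_prodCfg_ge_of_pencil_of_coer_centre_located posDefTr_deltaAY_parBY_prodCfg_of_pencil_of_coer_centre_located)
open Literature.MathematicalPhysics.QuantumFieldTheory.Balaban1983to89.B13SiteReadingNumerals (fineReadingY)
open Literature.MathematicalPhysics.QuantumFieldTheory.Balaban1983to89.B13BlockBondReadingNumerals (bondReadingY)

variable {d ℓ : ℕ} {hd : 1 ≤ d + 1} {hL : Odd (ℓ + 1) ∧ 1 < ℓ + 1} {b₀ b₁ : ℝ}
variable (i : KIdx d ℓ hd hL b₀ b₁) {N : ℕ} [NeZero N] {G : Subgroup (Matrix (Fin N) (Fin N) ℂ)ˣ}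

/-- ★★★★ **COERCIVITY OF `Δ_a` ON THE WHOLE CHART-BALL FAMILY AROUND EVERY BACKGROUND OF THE CLASS (3.35), FROM ITS COERCIVITY AT THE CENTRE.**  For EVERY
`U₀ ∈ (bg9K (M_N ℂ) G i).Reg335 c α₀` (`G ≤ U(N)`, `0 ≤ c·M·α₀`, `c·M·α₀·(d+1) ≤ 1∕16`): the R-station's output on (3.35) at the fine reading (dag-n10-w2 g4, fed by
dag-n10-w5's located X⁻¹; radius `R₁ ≤ R₁⋆ ≤ Rc`, rate `ρ″ − 2μ`) feeds `B13CoerciveAlongPencilLocated.trIP_deltaAY_parBY_prodCfg_ge_of_pencil_of_coer_centre_located`.  DISPLAYED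
ONLY: the (3.35) data, `η`, `0 < Rc`, the G′ rate window, the X⁻¹ window, the R-loss `0 < μ`, `2μ < ρ″`, `B′` with `hBΔ : ∀ R, 0 < R → R ≤ Rc → N(R) ≤ B′`, and the
centre's flat coercivity `m·⟨Ψ,Ψ⟩₁ ≤ ⟨Ψ, Δ_a(U₀)Ψ⟩₁`.  Conclusion: `∃ R₁, 0 < R₁ ∧ R₁ ≤ R₁⋆ ∧ ∀ R′, 0 ≤ R′ ≤ R₁ → ∀ ‖A′‖ < R′, ∀ Ψ,
(m − 2(B′((d+1)N²c₀(1,ρ″−2μ)^{d+1}))R′∕R₁)·⟨Ψ,Ψ⟩₁ ≤ ⟨Ψ, Δ_a(e^{iηA′}U₀)Ψ⟩₁` — the coercivity constant degrades at most linearly along the pencil, at a located rate.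
[cite: Balaban1985BackgroundPropagators, (3.19)–(3.27) pp.393–395, (3.34)–(3.35) p.396, Thm 3.1 (3.42) p.397, Thm 3.2 (3.48) p.398, (3.46)–(3.47) p.398, Thm 3.3 p.399, Thm 3.4 and (3.50) p.400, (3.62)–(3.64) p.402, (3.84) p.407, Thm 3.10 (3.107)–(3.108) pp.415–416, Thm 3.11 p.416; Balaban1984PropagatorsII, (2.19) and p.226, Lemma 2.1 (2.61) p.234; Balaban1988RG2Cluster, (2.5)–(2.7) pp.12–13, p.15] -/
theorem exists_trIP_deltaAY_recordV4_prodCfg_ge_ballFamily_of_reg335_of_coer_centre_located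
    (hG : G ≤ B7Prop2Explicit.unitaryUnits (Matrix (Fin N) (Fin N) ℂ))
    {U₀ : CfgY (Matrix (Fin N) (Fin N) ℂ) i} {c α₀ : ℝ} (hC0 : 0 ≤ c * (kGeo i).M * α₀) (hC1 : c * (kGeo i).M * α₀ * ((d : ℝ) + 1) ≤ 1 / 16)
    (hreg : (bg9K (Matrix (Fin N) (Fin N) ℂ) G i).Reg335 c α₀ U₀)
    (η : ℝ) {Rc : ℝ} (hRc : 0 < Rc) {ρ' : ℝ} (hρ'0 : 0 ≤ ρ')
    (hρ' : ρ' < (1 / (4 * ((d : ℝ) + 2))) * ((((d : ℝ) + 1) * ((((ℓ + 1) ^ i.k : ℕ) : ℝ)))⁻¹))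
    {μX : ℝ} (hμX : 0 < μX) (hμρ : μX < ρ')
    {κX : ℝ} (hκX : 0 ≤ κX) (hκ4X : κX ≤ (ρ' - μX) / 4)
    (hκmX : 8 * (Real.sqrt ((((ℓ : ℝ) + 1) ^ i.k) ^ (d + 1)) *
        (1 * (Fintype.card (Fin N × Fin N) : ℝ) *
            (1 * ((1 * Real.exp (|η| * Rc)) ^ ((d + 1) * ((ℓ + 1) ^ i.k - 1)) * 1 * (1 * Real.exp (|η| * Rc)) ^ ((d + 1) * ((ℓ + 1) ^ i.k - 1)))) *
          ((((ℓ : ℝ) + 1) ^ i.k) ^ (d + 1) * (Fintype.card (Fin N × Fin N) : ℝ) *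
            (1 * ((1 * Real.exp (|η| * Rc)) ^ ((d + 1) * ((ℓ + 1) ^ i.k - 1)) * 1 * (1 * Real.exp (|η| * Rc)) ^ ((d + 1) * ((ℓ + 1) ^ i.k - 1))))) *
          ((2 * (1 * 1 * (16 * ((((ℓ + 1) ^ i.k : ℕ) : ℝ)) ^ 2 * Real.sqrt N))) * (2 * (1 * 1 * (16 * ((((ℓ + 1) ^ i.k : ℕ) : ℝ)) ^ 2 * Real.sqrt N))) *
            (((N * N : ℕ) : ℝ) * B6.c0 1 μX ^ (d + 1))) *
          Real.exp (2 * (ρ' - μX) * (((d : ℝ) + 1) * (((((ℓ + 1) ^ i.k : ℕ) : ℝ)) - 1))))) * κX *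
        (((N * N : ℕ) : ℝ) * B6.c0 1 ((ρ' - μX) / 2) ^ (d + 1)) ≤
      ((4 * ((d : ℝ) + 1) + 1) ^ 2)⁻¹ * (ρ' - μX))
    {ρ'' : ℝ} (hρ''0 : 0 ≤ ρ'') (hρ'' : ρ'' < κX)
    {μ : ℝ} (hμ : 0 < μ) (h2μ : 2 * μ < ρ'')
    {B' : ℝ}
    (hBΔ : ∀ R : ℝ, 0 < R → R ≤ Rc →
      1 * (((4 * ((d : ℝ) + 1) * |i.cf|) * ((1 * Real.exp (|η| * R)) * ((1 * Real.exp (|η| * R)) ^ 4 * ((4 * |i.cf|) * ((1 * Real.exp (|η| * R)) * 1 * (1 * Real.exp (|η| * R))))) * (1 * Real.exp (|η| * R))) + 1 / 2 * ((4 * ((d : ℝ) + 1)) * ((1 * Real.exp (|η| * R)) * (2 * (i.cf ^ 2 * (1 * Real.exp (|η| * R)) ^ 4) * (8 * ((1 * Real.exp (|η| * R)) * 1 * (1 * Real.exp (|η| * R))))) * (1 * Real.exp (|η| * R))))) + 2 * ((1 * Real.exp (|η| * R)) ^ ((d + 2) * ((ℓ + 1) ^ i.k - 1)) * ((|b₁|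 * i.cf ^ 2 * ((((ℓ + 1 : ℕ) : ℝ)) ^ i.k) ^ (d + 1)) * (1 * ((1 * Real.exp (|η| * R)) ^ ((d + 2) * ((ℓ + 1) ^ i.k - 1)) * 1 * (1 * Real.exp (|η| * R)) ^ ((d + 2) * ((ℓ + 1) ^ i.k - 1))))) * (1 * Real.exp (|η| * R)) ^ ((d + 2) * ((ℓ + 1) ^ i.k - 1)))) * Real.exp ((ρ'' - 2 * μ) * (2 * (((d : ℝ) + 2) * ((((ℓ + 1) ^ i.k : ℕ) : ℝ) - 1)))) +
          (2 * |i.cf|) * (Fintype.card (Fin N × Fin N) : ℝ) * (1 * ((1 * Real.exp (|η| * R)) * 1 * (1 * Real.exp (|η| * R)))) * ((2 * |i.cf|) * (Fintype.card (Fin N × Fin N) : ℝ) * (1 * ((1 * Real.exp (|η| * R)) * 1 * (1 * Real.exp (|η| * R))))) * (1 + 2 * (1 * 1 * (16 * ((((ℓ + 1) ^ i.k : ℕ) : ℝ)) ^ 2 * Real.sqrt N)) *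
            (1 * (Fintype.card (Fin N × Fin N) : ℝ) *
                (1 * ((1 * Real.exp (|η| * R)) ^ ((d + 1) * ((ℓ + 1) ^ i.k - 1)) * 1 * (1 * Real.exp (|η| * R)) ^ ((d + 1) * ((ℓ + 1) ^ i.k - 1)))) *
              (1 * (Fintype.card (Fin N × Fin N) : ℝ) *
                (1 * ((1 * Real.exp (|η| * R)) ^ ((d + 1) * ((ℓ + 1) ^ i.k - 1)) * 1 * (1 * Real.exp (|η| * R)) ^ ((d + 1) * ((ℓ + 1) ^ i.k - 1))))) *
              (2 * (1 * 1 * ((N : ℝ) ^ 3 * (Real.sqrt ((((ℓ : ℝ) + 1) ^ i.k) ^ (d + 1)) * (4 / ((4 * ((d : ℝ) + 1) + 1) ^ 2)⁻¹))))) *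
              Real.exp (2 * ρ'' * (((d : ℝ) + 1) * ((((ℓ + 1) ^ i.k : ℕ) : ℝ) - 1))) * (2 * (1 * 1 * (16 * ((((ℓ + 1) ^ i.k : ℕ) : ℝ)) ^ 2 * Real.sqrt N))) *
              (((N * N : ℕ) : ℝ) * B6.c0 1 μ ^ (d + 1))) *
            (((N * N : ℕ) : ℝ) * B6.c0 1 μ ^ (d + 1))) * Real.exp (2 * (ρ'' - 2 * μ) * 1) ≤ B')
    {m : ℝ}
    (hco : ∀ Ψ : FBondY i → Matrix (Fin N) (Fin N) ℂ,
      m * trIP (fun _ => (1 : ℝ)) Ψ Ψ ≤ trIP (fun _ => (1 : ℝ)) Ψ (deltaAY i (parSymY i) (parBY i) (GpY i (parSymY i)) U₀ Ψ)) :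
    ∃ R₁ : ℝ, 0 < R₁ ∧ R₁ ≤ Rc / (4 * ((1 * (((d : ℝ) + 1) * (1 * Real.exp (|η| * Rc) * (1 * Real.exp (|η| * Rc) * 1 * (1 * Real.exp (|η| * Rc)) + 1) * (1 * Real.exp (|η| * Rc)) +
            (1 * Real.exp (|η| * Rc) * 1 * (1 * Real.exp (|η| * Rc)) + 1)) + 1 * ((1 * Real.exp (|η| * Rc)) ^ (2 * (d + 1) * ((ℓ + 1) ^ i.k - 1)) * 1 * (1 * Real.exp (|η| * Rc)) ^ (2 * (d + 1) * ((ℓ + 1) ^ i.k - 1)))) *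
            Real.exp ((1 / (4 * ((d : ℝ) + 2)) * ((((d : ℝ) + 1) * ((((ℓ + 1) ^ i.k : ℕ) : ℝ)))⁻¹)) * (((d : ℝ) + 1) * ((((ℓ + 1) ^ i.k : ℕ) : ℝ))))) * (1 * 1 * (16 * ((((ℓ + 1) ^ i.k : ℕ) : ℝ)) ^ 2 * Real.sqrt N)) *
          (((N * N : ℕ) : ℝ) * B6.c0 1 (((1 / (4 * ((d : ℝ) + 2))) * ((((d : ℝ) + 1) * ((((ℓ + 1) ^ i.k : ℕ) : ℝ)))⁻¹) - ρ') / 3) ^ (d + 1)) *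
          (((N * N : ℕ) : ℝ) * B6.c0 1 (((1 / (4 * ((d : ℝ) + 2))) * ((((d : ℝ) + 1) * ((((ℓ + 1) ^ i.k : ℕ) : ℝ)))⁻¹) - ρ') / 3) ^ (d + 1))) + 1) ∧
  ∀ ⦃R' : ℝ⦄, 0 ≤ R' → R' ≤ R₁ → ∀ a ∈ ball (0 : Fin (d + 1) → Site (PV d ℓ i.m i.K hd hL) 0 → Matrix (Fin N) (Fin N) ℂ) R', ∀ Ψ : FBondY i → Matrix (Fin N) (Fin N) ℂ,
      (m - 2 * (B' * ((((d + 1) * (N * N) : ℕ) : ℝ) * B6.c0 1 (ρ'' - 2 * μ) ^ (d + 1))) * R' / R₁) * trIP (fun _ => (1 : ℝ)) Ψ Ψ ≤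
        trIP (fun _ => (1 : ℝ)) Ψ (deltaAY i (parSymY i) (parBY i) (GpY i (parSymY i)) (prodCfg U₀ η a) Ψ) := by
  -- R along the pencil on (3.35) at the fine reading, `hXi` discharged (dag-n10-w2 g4 ∘ dag-n10-w5), at some radius `0 < R₁ ≤ R₁⋆`
  obtain ⟨R₁, hR₁, hR₁le, hR⟩ :=
    B13OpsYPencilRProjSymLocated.rawEntryLetters_toMatrix_RY_parSymY_prodCfg_of_reg335_located_of_xinvLocated i hG hC0 hC1 hreg η hRc hρ'0 hρ' hμX hμρ hκX
      hκ4X hκmX hρ''0 hρ'' hμ h2μ.le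
  -- `R₁⋆ ≤ Rc`: the thin radius divides `Rc` by `4T + 1 ≥ 1`
  have hT : 0 ≤ ((1 * (((d : ℝ) + 1) *
          (1 * Real.exp (|η| * Rc) * (1 * Real.exp (|η| * Rc) * 1 * (1 * Real.exp (|η| * Rc)) + 1) * (1 * Real.exp (|η| * Rc)) +
            (1 * Real.exp (|η| * Rc) * 1 * (1 * Real.exp (|η| * Rc)) + 1)) +
          1 * ((1 * Real.exp (|η| * Rc)) ^ (2 * (d + 1) * ((ℓ + 1) ^ i.k - 1)) * 1 * (1 * Real.exp (|η| * Rc)) ^ (2 * (d + 1) * ((ℓ + 1) ^ i.k - 1)))) *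
            Real.exp ((1 / (4 * ((d : ℝ) + 2)) * ((((d : ℝ) + 1) * ((((ℓ + 1) ^ i.k : ℕ) : ℝ)))⁻¹)) * (((d : ℝ) + 1) * ((((ℓ + 1) ^ i.k : ℕ) : ℝ))))) *
          (1 * 1 * (16 * ((((ℓ + 1) ^ i.k : ℕ) : ℝ)) ^ 2 * Real.sqrt N)) *
          (((N * N : ℕ) : ℝ) * B6.c0 1 (((1 / (4 * ((d : ℝ) + 2))) * ((((d : ℝ) + 1) * ((((ℓ + 1) ^ i.k : ℕ) : ℝ)))⁻¹) - ρ') / 3) ^ (d + 1)) *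
          (((N * N : ℕ) : ℝ) * B6.c0 1 (((1 / (4 * ((d : ℝ) + 2))) * ((((d : ℝ) + 1) * ((((ℓ + 1) ^ i.k : ℕ) : ℝ)))⁻¹) - ρ') / 3) ^ (d + 1))) :=
    mul_nonneg (mul_nonneg (mul_nonneg
      (mul_nonneg (mul_nonneg zero_le_one (add_nonneg (by positivity) (mul_nonneg zero_le_one (by positivity)))) (Real.exp_pos _).le)
      (by positivity)) (mul_nonneg (Nat.cast_nonneg _) (pow_nonneg (B6RandomWalk.c0_nonneg 1 _) _)))
      (mul_nonneg (Nat.cast_nonneg _) (pow_nonneg (B6RandomWalk.c0_nonneg 1 _) _))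
  have hR₁Rc : R₁ ≤ Rc := hR₁le.trans (div_le_self hRc.le (by linarith))
  have hρR : 0 < ρ'' - 2 * μ := by linarith
  exact ⟨R₁, hR₁, hR₁le, fun R' hR'0 hR'R =>
    trIP_deltaAY_parBY_prodCfg_ge_of_pencil_of_coer_centre_located i (parSymY i) (GpY i (parSymY i)) hG hreg.1 i.hN η hR₁.le hρR hR (hBΔ R₁ hR₁ hR₁Rc) hco
      hR'0 hR'R⟩

/-- ★★★★ **THEOREM 3.11's CLAUSE ON A LOCATED CHART BALL AROUND EVERY COERCIVE BACKGROUND OF THE CLASS (3.35)** — the clean member: with `0 < m`, for EVERY `U₀` in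
(3.35) at which `Δ_a(U₀)` is `m`-coercive, `∃ R₁, 0 < R₁ ∧ R₁ ≤ R₁⋆ ∧ ∀ ‖A′‖ < R₁·m∕(m + 2B′c_V), PosDefTr 1 (Δ_a(e^{iηA′}U₀))` (`c_V = (d+1)N²c₀(1,ρ″−2μ)^{d+1}`;
`2(B′c_V)·R₁m∕(m + 2B′c_V) < mR₁`) — an OPEN inhabitant class of the N06 certificate's row-17 clause around every coercive member of (3.35), radius a FIXED FRACTION of
the R-station's radius; displayed as in `exists_trIP_deltaAY_recordV4_prodCfg_ge_ballFamily_of_reg335_of_coer_centre_located` plus `0 < m`.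
[cite: Balaban1985BackgroundPropagators, (3.19)–(3.27) pp.393–395, (3.34)–(3.35) p.396, Thm 3.1 (3.42) p.397, Thm 3.2 (3.48) p.398, (3.46)–(3.47) p.398, Thm 3.3 p.399, Thm 3.4 and (3.50) p.400, (3.62)–(3.64) p.402, (3.84) p.407, Thm 3.10 (3.107)–(3.108) pp.415–416, Thm 3.11 p.416; Balaban1984PropagatorsII, (2.19) and p.226, Lemma 2.1 (2.61) p.234; Balaban1988RG2Cluster, (2.5)–(2.7) pp.12–13, p.15] -/
theorem exists_ball_posDefTr_deltaAY_recordV4_prodCfg_of_reg335_of_coer_centre_located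
    (hG : G ≤ B7Prop2Explicit.unitaryUnits (Matrix (Fin N) (Fin N) ℂ))
    {U₀ : CfgY (Matrix (Fin N) (Fin N) ℂ) i} {c α₀ : ℝ} (hC0 : 0 ≤ c * (kGeo i).M * α₀) (hC1 : c * (kGeo i).M * α₀ * ((d : ℝ) + 1) ≤ 1 / 16)
    (hreg : (bg9K (Matrix (Fin N) (Fin N) ℂ) G i).Reg335 c α₀ U₀)
    (η : ℝ) {Rc : ℝ} (hRc : 0 < Rc) {ρ' : ℝ} (hρ'0 : 0 ≤ ρ')
    (hρ' : ρ' < (1 / (4 * ((d : ℝ) + 2))) * ((((d : ℝ) + 1) * ((((ℓ + 1) ^ i.k : ℕ) : ℝ)))⁻¹))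
    {μX : ℝ} (hμX : 0 < μX) (hμρ : μX < ρ')
    {κX : ℝ} (hκX : 0 ≤ κX) (hκ4X : κX ≤ (ρ' - μX) / 4)
    (hκmX : 8 * (Real.sqrt ((((ℓ : ℝ) + 1) ^ i.k) ^ (d + 1)) *
        (1 * (Fintype.card (Fin N × Fin N) : ℝ) *
            (1 * ((1 * Real.exp (|η| * Rc)) ^ ((d + 1) * ((ℓ + 1) ^ i.k - 1)) * 1 * (1 * Real.exp (|η| * Rc)) ^ ((d + 1) * ((ℓ + 1) ^ i.k - 1)))) *
          ((((ℓ : ℝ) + 1) ^ i.k) ^ (d + 1) * (Fintype.card (Fin N × Fin N) : ℝ) *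
            (1 * ((1 * Real.exp (|η| * Rc)) ^ ((d + 1) * ((ℓ + 1) ^ i.k - 1)) * 1 * (1 * Real.exp (|η| * Rc)) ^ ((d + 1) * ((ℓ + 1) ^ i.k - 1))))) *
          ((2 * (1 * 1 * (16 * ((((ℓ + 1) ^ i.k : ℕ) : ℝ)) ^ 2 * Real.sqrt N))) * (2 * (1 * 1 * (16 * ((((ℓ + 1) ^ i.k : ℕ) : ℝ)) ^ 2 * Real.sqrt N))) *
            (((N * N : ℕ) : ℝ) * B6.c0 1 μX ^ (d + 1))) *
          Real.exp (2 * (ρ' - μX) * (((d : ℝ) + 1) * (((((ℓ + 1) ^ i.k : ℕ) : ℝ)) - 1))))) * κX *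
        (((N * N : ℕ) : ℝ) * B6.c0 1 ((ρ' - μX) / 2) ^ (d + 1)) ≤
      ((4 * ((d : ℝ) + 1) + 1) ^ 2)⁻¹ * (ρ' - μX))
    {ρ'' : ℝ} (hρ''0 : 0 ≤ ρ'') (hρ'' : ρ'' < κX)
    {μ : ℝ} (hμ : 0 < μ) (h2μ : 2 * μ < ρ'')
    {B' : ℝ}
    (hBΔ : ∀ R : ℝ, 0 < R → R ≤ Rc →
      1 * (((4 * ((d : ℝ) + 1) * |i.cf|) * ((1 * Real.exp (|η| * R)) * ((1 * Real.exp (|η| * R)) ^ 4 * ((4 * |i.cf|) * ((1 * Real.exp (|η| * R)) * 1 * (1 * Real.exp (|η| * R))))) * (1 * Real.exp (|η| * R))) + 1 / 2 * ((4 * ((d : ℝ) + 1)) * ((1 * Real.exp (|η| * R)) * (2 * (i.cf ^ 2 * (1 * Real.exp (|η| * R)) ^ 4) * (8 * ((1 * Real.exp (|η| * R)) * 1 * (1 * Real.exp (|η| * R))))) * (1 * Real.exp (|η| * R))))) + 2 * ((1 * Real.exp (|η| * R)) ^ ((d + 2) * ((ℓ + 1) ^ i.k - 1)) * ((|b₁|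 * i.cf ^ 2 * ((((ℓ + 1 : ℕ) : ℝ)) ^ i.k) ^ (d + 1)) * (1 * ((1 * Real.exp (|η| * R)) ^ ((d + 2) * ((ℓ + 1) ^ i.k - 1)) * 1 * (1 * Real.exp (|η| * R)) ^ ((d + 2) * ((ℓ + 1) ^ i.k - 1))))) * (1 * Real.exp (|η| * R)) ^ ((d + 2) * ((ℓ + 1) ^ i.k - 1)))) * Real.exp ((ρ'' - 2 * μ) * (2 * (((d : ℝ) + 2) * ((((ℓ + 1) ^ i.k : ℕ) : ℝ) - 1)))) +
          (2 * |i.cf|) * (Fintype.card (Fin N × Fin N) : ℝ) * (1 * ((1 * Real.exp (|η| * R)) * 1 * (1 * Real.exp (|η| * R)))) * ((2 * |i.cf|) * (Fintype.card (Fin N × Fin N) : ℝ) * (1 * ((1 * Real.exp (|η| * R)) * 1 * (1 * Real.exp (|η| * R))))) * (1 + 2 * (1 * 1 * (16 * ((((ℓ + 1) ^ i.k : ℕ) : ℝ)) ^ 2 * Real.sqrt N)) *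
            (1 * (Fintype.card (Fin N × Fin N) : ℝ) *
                (1 * ((1 * Real.exp (|η| * R)) ^ ((d + 1) * ((ℓ + 1) ^ i.k - 1)) * 1 * (1 * Real.exp (|η| * R)) ^ ((d + 1) * ((ℓ + 1) ^ i.k - 1)))) *
              (1 * (Fintype.card (Fin N × Fin N) : ℝ) *
                (1 * ((1 * Real.exp (|η| * R)) ^ ((d + 1) * ((ℓ + 1) ^ i.k - 1)) * 1 * (1 * Real.exp (|η| * R)) ^ ((d + 1) * ((ℓ + 1) ^ i.k - 1))))) *
              (2 * (1 * 1 * ((N : ℝ) ^ 3 * (Real.sqrt ((((ℓ : ℝ) + 1) ^ i.k) ^ (d + 1)) * (4 / ((4 * ((d : ℝ) + 1) + 1) ^ 2)⁻¹))))) *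
              Real.exp (2 * ρ'' * (((d : ℝ) + 1) * ((((ℓ + 1) ^ i.k : ℕ) : ℝ) - 1))) * (2 * (1 * 1 * (16 * ((((ℓ + 1) ^ i.k : ℕ) : ℝ)) ^ 2 * Real.sqrt N))) *
              (((N * N : ℕ) : ℝ) * B6.c0 1 μ ^ (d + 1))) *
            (((N * N : ℕ) : ℝ) * B6.c0 1 μ ^ (d + 1))) * Real.exp (2 * (ρ'' - 2 * μ) * 1) ≤ B')
    {m : ℝ} (hm : 0 < m)
    (hco : ∀ Ψ : FBondY i → Matrix (Fin N) (Fin N) ℂ,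
      m * trIP (fun _ => (1 : ℝ)) Ψ Ψ ≤ trIP (fun _ => (1 : ℝ)) Ψ (deltaAY i (parSymY i) (parBY i) (GpY i (parSymY i)) U₀ Ψ)) :
    ∃ R₁ : ℝ, 0 < R₁ ∧ R₁ ≤ Rc / (4 * ((1 * (((d : ℝ) + 1) * (1 * Real.exp (|η| * Rc) * (1 * Real.exp (|η| * Rc) * 1 * (1 * Real.exp (|η| * Rc)) + 1) * (1 * Real.exp (|η| * Rc)) +
            (1 * Real.exp (|η| * Rc) * 1 * (1 * Real.exp (|η| * Rc)) + 1)) + 1 * ((1 * Real.exp (|η| * Rc)) ^ (2 * (d + 1) * ((ℓ + 1) ^ i.k - 1)) * 1 * (1 * Real.exp (|η| * Rc)) ^ (2 * (d + 1) * ((ℓ + 1) ^ i.k - 1)))) *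
            Real.exp ((1 / (4 * ((d : ℝ) + 2)) * ((((d : ℝ) + 1) * ((((ℓ + 1) ^ i.k : ℕ) : ℝ)))⁻¹)) * (((d : ℝ) + 1) * ((((ℓ + 1) ^ i.k : ℕ) : ℝ))))) * (1 * 1 * (16 * ((((ℓ + 1) ^ i.k : ℕ) : ℝ)) ^ 2 * Real.sqrt N)) *
          (((N * N : ℕ) : ℝ) * B6.c0 1 (((1 / (4 * ((d : ℝ) + 2))) * ((((d : ℝ) + 1) * ((((ℓ + 1) ^ i.k : ℕ) : ℝ)))⁻¹) - ρ') / 3) ^ (d + 1)) *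
          (((N * N : ℕ) : ℝ) * B6.c0 1 (((1 / (4 * ((d : ℝ) + 2))) * ((((d : ℝ) + 1) * ((((ℓ + 1) ^ i.k : ℕ) : ℝ)))⁻¹) - ρ') / 3) ^ (d + 1))) + 1) ∧
  ∀ a ∈ ball (0 : Fin (d + 1) → Site (PV d ℓ i.m i.K hd hL) 0 → Matrix (Fin N) (Fin N) ℂ) (R₁ * (m / (m + 2 * (B' * ((((d + 1) * (N * N) : ℕ) : ℝ) * B6.c0 1 (ρ'' - 2 * μ) ^ (d + 1)))))),
      PosDefTr (fun _ => (1 : ℝ)) (deltaAY i (parSymY i) (parBY i) (GpY i (parSymY i)) (prodCfg U₀ η a)) := by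
  -- R along the pencil on (3.35) at the fine reading, `hXi` discharged (dag-n10-w2 g4 ∘ dag-n10-w5), at some radius `0 < R₁ ≤ R₁⋆`
  obtain ⟨R₁, hR₁, hR₁le, hR⟩ :=
    B13OpsYPencilRProjSymLocated.rawEntryLetters_toMatrix_RY_parSymY_prodCfg_of_reg335_located_of_xinvLocated i hG hC0 hC1 hreg η hRc hρ'0 hρ' hμX hμρ hκX
      hκ4X hκmX hρ''0 hρ'' hμ h2μ.le
  -- `R₁⋆ ≤ Rc`: the thin radius divides `Rc` by `4T + 1 ≥ 1`
  have hT : 0 ≤ ((1 * (((d : ℝ) + 1) *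
          (1 * Real.exp (|η| * Rc) * (1 * Real.exp (|η| * Rc) * 1 * (1 * Real.exp (|η| * Rc)) + 1) * (1 * Real.exp (|η| * Rc)) +
            (1 * Real.exp (|η| * Rc) * 1 * (1 * Real.exp (|η| * Rc)) + 1)) +
          1 * ((1 * Real.exp (|η| * Rc)) ^ (2 * (d + 1) * ((ℓ + 1) ^ i.k - 1)) * 1 * (1 * Real.exp (|η| * Rc)) ^ (2 * (d + 1) * ((ℓ + 1) ^ i.k - 1)))) *
            Real.exp ((1 / (4 * ((d : ℝ) + 2)) * ((((d : ℝ) + 1) * ((((ℓ + 1) ^ i.k : ℕ) : ℝ)))⁻¹)) * (((d : ℝ) + 1) * ((((ℓ + 1) ^ i.k : ℕ) : ℝ))))) *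
          (1 * 1 * (16 * ((((ℓ + 1) ^ i.k : ℕ) : ℝ)) ^ 2 * Real.sqrt N)) *
          (((N * N : ℕ) : ℝ) * B6.c0 1 (((1 / (4 * ((d : ℝ) + 2))) * ((((d : ℝ) + 1) * ((((ℓ + 1) ^ i.k : ℕ) : ℝ)))⁻¹) - ρ') / 3) ^ (d + 1)) *
          (((N * N : ℕ) : ℝ) * B6.c0 1 (((1 / (4 * ((d : ℝ) + 2))) * ((((d : ℝ) + 1) * ((((ℓ + 1) ^ i.k : ℕ) : ℝ)))⁻¹) - ρ') / 3) ^ (d + 1))) :=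
    mul_nonneg (mul_nonneg (mul_nonneg
      (mul_nonneg (mul_nonneg zero_le_one (add_nonneg (by positivity) (mul_nonneg zero_le_one (by positivity)))) (Real.exp_pos _).le)
      (by positivity)) (mul_nonneg (Nat.cast_nonneg _) (pow_nonneg (B6RandomWalk.c0_nonneg 1 _) _)))
      (mul_nonneg (Nat.cast_nonneg _) (pow_nonneg (B6RandomWalk.c0_nonneg 1 _) _))
  have hR₁Rc : R₁ ≤ Rc := hR₁le.trans (div_le_self hRc.le (by linarith))
  have hρR : 0 < ρ'' - 2 * μ := by linarith
  -- Δ_a's letters at the record (for `0 ≤ B′`) and the numeral `c_V ≥ 0`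
  have hA := rawEntryLetters_toMatrix_deltaAY_parBY_prodCfg_of_pencil_located i (parSymY i) (GpY i (parSymY i)) hG hreg.1 i.hN η hR₁.le hρR.le hR
  have hB'0 : 0 ≤ B' := hA.B_nonneg.trans (hBΔ R₁ hR₁ hR₁Rc)
  set cV : ℝ := ((((d + 1) * (N * N) : ℕ) : ℝ) * B6.c0 1 (ρ'' - 2 * μ) ^ (d + 1)) with hcV
  have hcV0 : 0 ≤ cV := mul_nonneg (Nat.cast_nonneg _) (pow_nonneg (B6RandomWalk.c0_nonneg 1 _) _)
  have hc : 0 ≤ B' * cV := mul_nonneg hB'0 hcV0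
  have hden : 0 < m + 2 * (B' * cV) := by positivity
  have hq0 : 0 ≤ m / (m + 2 * (B' * cV)) := div_nonneg hm.le hden.le
  have hq1 : m / (m + 2 * (B' * cV)) ≤ 1 := by rw [div_le_one hden]; linarith
  have hR'0 : 0 ≤ R₁ * (m / (m + 2 * (B' * cV))) := mul_nonneg hR₁.le hq0
  have hR'R : R₁ * (m / (m + 2 * (B' * cV))) ≤ R₁ := mul_le_of_le_one_right hR₁.le hq1
  -- the smallness `2(B′c_V)R′ < m·R₁` at `R′ = R₁·m∕(m + 2B′c_V)`
  have hsmall : 2 * (B' * cV) * (R₁ * (m / (m + 2 * (B' * cV)))) < m * R₁ := by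
    have h1 : 2 * (B' * cV) * (R₁ * (m / (m + 2 * (B' * cV)))) = (2 * (B' * cV) / (m + 2 * (B' * cV))) * (m * R₁) := by
      field_simp
    have h2 : 2 * (B' * cV) / (m + 2 * (B' * cV)) < 1 := by rw [div_lt_one hden]; linarith
    rw [h1]
    exact mul_lt_of_lt_one_left (mul_pos hm hR₁) h2
  exact ⟨R₁, hR₁, hR₁le, posDefTr_deltaAY_parBY_prodCfg_of_pencil_of_coer_centre_located i (parSymY i) (GpY i (parSymY i)) hG hreg.1 i.hN η hR₁.le hρR hR
    (hBΔ R₁ hR₁ hR₁Rc) hm hco hR'0 hR'R hsmall⟩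

/-- ★★★★ **… AND ON THE GAUGE ORBIT OF THAT BALL** (for every unitary-valued gauge transformation `u`): `∃ R₁, 0 < R₁ ∧ R₁ ≤ R₁⋆ ∧ ∀ ‖A′‖ < R₁·m∕(m + 2B′c_V),
PosDefTr 1 (Δ_a((e^{iηA′}U₀)^u))` — an OPEN GAUGE-INVARIANT inhabitant class of row 17 around the orbit of every coercive member of (3.35) ((3.34), n06-j's
`posDefTr_deltaAY_parSymY_gaugeY_iff`); displayed as in `exists_ball_posDefTr_deltaAY_recordV4_prodCfg_of_reg335_of_coer_centre_located` plus `hu`.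
[cite: Balaban1985BackgroundPropagators, (3.19)–(3.27) pp.393–395, (3.34)–(3.35) p.396, Thm 3.1 (3.42) p.397, Thm 3.2 (3.48) p.398, (3.46)–(3.47) p.398, Thm 3.3 p.399, Thm 3.4 and (3.50) p.400, (3.62)–(3.64) p.402, (3.84) p.407, Thm 3.10 (3.107)–(3.108) pp.415–416, Thm 3.11 p.416; Balaban1984PropagatorsII, (2.19) and p.226, Lemma 2.1 (2.61) p.234; Balaban1988RG2Cluster, (2.5)–(2.7) pp.12–13, p.15] -/
theorem exists_ball_posDefTr_deltaAY_gaugeY_recordV4_prodCfg_of_reg335_of_coer_centre_located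
    (hG : G ≤ B7Prop2Explicit.unitaryUnits (Matrix (Fin N) (Fin N) ℂ))
    {U₀ : CfgY (Matrix (Fin N) (Fin N) ℂ) i} {c α₀ : ℝ} (hC0 : 0 ≤ c * (kGeo i).M * α₀) (hC1 : c * (kGeo i).M * α₀ * ((d : ℝ) + 1) ≤ 1 / 16)
    (hreg : (bg9K (Matrix (Fin N) (Fin N) ℂ) G i).Reg335 c α₀ U₀)
    (η : ℝ) {Rc : ℝ} (hRc : 0 < Rc) {ρ' : ℝ} (hρ'0 : 0 ≤ ρ')
    (hρ' : ρ' < (1 / (4 * ((d : ℝ) + 2))) * ((((d : ℝ) + 1) * ((((ℓ + 1) ^ i.k : ℕ) : ℝ)))⁻¹))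
    {μX : ℝ} (hμX : 0 < μX) (hμρ : μX < ρ')
    {κX : ℝ} (hκX : 0 ≤ κX) (hκ4X : κX ≤ (ρ' - μX) / 4)
    (hκmX : 8 * (Real.sqrt ((((ℓ : ℝ) + 1) ^ i.k) ^ (d + 1)) *
        (1 * (Fintype.card (Fin N × Fin N) : ℝ) *
            (1 * ((1 * Real.exp (|η| * Rc)) ^ ((d + 1) * ((ℓ + 1) ^ i.k - 1)) * 1 * (1 * Real.exp (|η| * Rc)) ^ ((d + 1) * ((ℓ + 1) ^ i.k - 1)))) *
          ((((ℓ : ℝ) + 1) ^ i.k) ^ (d + 1) * (Fintype.card (Fin N × Fin N) : ℝ) *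
            (1 * ((1 * Real.exp (|η| * Rc)) ^ ((d + 1) * ((ℓ + 1) ^ i.k - 1)) * 1 * (1 * Real.exp (|η| * Rc)) ^ ((d + 1) * ((ℓ + 1) ^ i.k - 1))))) *
          ((2 * (1 * 1 * (16 * ((((ℓ + 1) ^ i.k : ℕ) : ℝ)) ^ 2 * Real.sqrt N))) * (2 * (1 * 1 * (16 * ((((ℓ + 1) ^ i.k : ℕ) : ℝ)) ^ 2 * Real.sqrt N))) *
            (((N * N : ℕ) : ℝ) * B6.c0 1 μX ^ (d + 1))) *
          Real.exp (2 * (ρ' - μX) * (((d : ℝ) + 1) * (((((ℓ + 1) ^ i.k : ℕ) : ℝ)) - 1))))) * κX *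
        (((N * N : ℕ) : ℝ) * B6.c0 1 ((ρ' - μX) / 2) ^ (d + 1)) ≤
      ((4 * ((d : ℝ) + 1) + 1) ^ 2)⁻¹ * (ρ' - μX))
    {ρ'' : ℝ} (hρ''0 : 0 ≤ ρ'') (hρ'' : ρ'' < κX)
    {μ : ℝ} (hμ : 0 < μ) (h2μ : 2 * μ < ρ'')
    {B' : ℝ}
    (hBΔ : ∀ R : ℝ, 0 < R → R ≤ Rc →
      1 * (((4 * ((d : ℝ) + 1) * |i.cf|) * ((1 * Real.exp (|η| * R)) * ((1 * Real.exp (|η| * R)) ^ 4 * ((4 * |i.cf|) * ((1 * Real.exp (|η| * R)) * 1 * (1 * Real.exp (|η| * R))))) * (1 * Real.exp (|η| * R))) + 1 / 2 * ((4 * ((d : ℝ) + 1)) * ((1 * Real.exp (|η| * R)) * (2 * (i.cf ^ 2 * (1 * Real.exp (|η| * R)) ^ 4) * (8 * ((1 * Real.exp (|η| * R)) * 1 * (1 * Real.exp (|η| * R))))) * (1 * Real.exp (|η| * R))))) + 2 * ((1 * Real.exp (|η| * R)) ^ ((d + 2) * ((ℓ + 1) ^ i.k - 1)) * ((|b₁|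 * i.cf ^ 2 * ((((ℓ + 1 : ℕ) : ℝ)) ^ i.k) ^ (d + 1)) * (1 * ((1 * Real.exp (|η| * R)) ^ ((d + 2) * ((ℓ + 1) ^ i.k - 1)) * 1 * (1 * Real.exp (|η| * R)) ^ ((d + 2) * ((ℓ + 1) ^ i.k - 1))))) * (1 * Real.exp (|η| * R)) ^ ((d + 2) * ((ℓ + 1) ^ i.k - 1)))) * Real.exp ((ρ'' - 2 * μ) * (2 * (((d : ℝ) + 2) * ((((ℓ + 1) ^ i.k : ℕ) : ℝ) - 1)))) +
          (2 * |i.cf|) * (Fintype.card (Fin N × Fin N) : ℝ) * (1 * ((1 * Real.exp (|η| * R)) * 1 * (1 * Real.exp (|η| * R)))) * ((2 * |i.cf|) * (Fintype.card (Fin N × Fin N) : ℝ) * (1 * ((1 * Real.exp (|η| * R)) * 1 * (1 * Real.exp (|η| * R))))) * (1 + 2 * (1 * 1 * (16 * ((((ℓ + 1) ^ i.k : ℕ) : ℝ)) ^ 2 * Real.sqrt N)) *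
            (1 * (Fintype.card (Fin N × Fin N) : ℝ) *
                (1 * ((1 * Real.exp (|η| * R)) ^ ((d + 1) * ((ℓ + 1) ^ i.k - 1)) * 1 * (1 * Real.exp (|η| * R)) ^ ((d + 1) * ((ℓ + 1) ^ i.k - 1)))) *
              (1 * (Fintype.card (Fin N × Fin N) : ℝ) *
                (1 * ((1 * Real.exp (|η| * R)) ^ ((d + 1) * ((ℓ + 1) ^ i.k - 1)) * 1 * (1 * Real.exp (|η| * R)) ^ ((d + 1) * ((ℓ + 1) ^ i.k - 1))))) *
              (2 * (1 * 1 * ((N : ℝ) ^ 3 * (Real.sqrt ((((ℓ : ℝ) + 1) ^ i.k) ^ (d + 1)) * (4 / ((4 * ((d : ℝ) + 1) + 1) ^ 2)⁻¹))))) *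
              Real.exp (2 * ρ'' * (((d : ℝ) + 1) * ((((ℓ + 1) ^ i.k : ℕ) : ℝ) - 1))) * (2 * (1 * 1 * (16 * ((((ℓ + 1) ^ i.k : ℕ) : ℝ)) ^ 2 * Real.sqrt N))) *
              (((N * N : ℕ) : ℝ) * B6.c0 1 μ ^ (d + 1))) *
            (((N * N : ℕ) : ℝ) * B6.c0 1 μ ^ (d + 1))) * Real.exp (2 * (ρ'' - 2 * μ) * 1) ≤ B')
    {m : ℝ} (hm : 0 < m)
    (hco : ∀ Ψ : FBondY i → Matrix (Fin N) (Fin N) ℂ,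
      m * trIP (fun _ => (1 : ℝ)) Ψ Ψ ≤ trIP (fun _ => (1 : ℝ)) Ψ (deltaAY i (parSymY i) (parBY i) (GpY i (parSymY i)) U₀ Ψ))
    {u : GaugeY (Matrix (Fin N) (Fin N) ℂ) i} (hu : ∀ x, ((u x : (Matrix (Fin N) (Fin N) ℂ)ˣ) : Matrix (Fin N) (Fin N) ℂ) ∈ unitary _) :
    ∃ R₁ : ℝ, 0 < R₁ ∧ R₁ ≤ Rc / (4 * ((1 * (((d : ℝ) + 1) * (1 * Real.exp (|η| * Rc) * (1 * Real.exp (|η| * Rc) * 1 * (1 * Real.exp (|η| * Rc)) + 1) * (1 * Real.exp (|η| * Rc)) +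
            (1 * Real.exp (|η| * Rc) * 1 * (1 * Real.exp (|η| * Rc)) + 1)) + 1 * ((1 * Real.exp (|η| * Rc)) ^ (2 * (d + 1) * ((ℓ + 1) ^ i.k - 1)) * 1 * (1 * Real.exp (|η| * Rc)) ^ (2 * (d + 1) * ((ℓ + 1) ^ i.k - 1)))) *
            Real.exp ((1 / (4 * ((d : ℝ) + 2)) * ((((d : ℝ) + 1) * ((((ℓ + 1) ^ i.k : ℕ) : ℝ)))⁻¹)) * (((d : ℝ) + 1) * ((((ℓ + 1) ^ i.k : ℕ) : ℝ))))) * (1 * 1 * (16 * ((((ℓ + 1) ^ i.k : ℕ) : ℝ)) ^ 2 * Real.sqrt N)) *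
          (((N * N : ℕ) : ℝ) * B6.c0 1 (((1 / (4 * ((d : ℝ) + 2))) * ((((d : ℝ) + 1) * ((((ℓ + 1) ^ i.k : ℕ) : ℝ)))⁻¹) - ρ') / 3) ^ (d + 1)) *
          (((N * N : ℕ) : ℝ) * B6.c0 1 (((1 / (4 * ((d : ℝ) + 2))) * ((((d : ℝ) + 1) * ((((ℓ + 1) ^ i.k : ℕ) : ℝ)))⁻¹) - ρ') / 3) ^ (d + 1))) + 1) ∧
  ∀ a ∈ ball (0 : Fin (d + 1) → Site (PV d ℓ i.m i.K hd hL) 0 → Matrix (Fin N) (Fin N) ℂ) (R₁ * (m / (m + 2 * (B' * ((((d + 1) * (N * N) : ℕ) : ℝ) * B6.c0 1 (ρ'' - 2 * μ) ^ (d + 1)))))),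
      PosDefTr (fun _ => (1 : ℝ)) (deltaAY i (parSymY i) (parBY i) (GpY i (parSymY i)) (gaugeY i u (prodCfg U₀ η a))) := by
  obtain ⟨R₁, hR₁, hR₁le, h⟩ := exists_ball_posDefTr_deltaAY_recordV4_prodCfg_of_reg335_of_coer_centre_located i hG hC0 hC1 hreg η hRc hρ'0 hρ' hμX hμρ hκX
    hκ4X hκmX hρ''0 hρ'' hμ h2μ hBΔ hm hco
  exact ⟨R₁, hR₁, hR₁le, fun a ha => (B9Thm311DeltaAGaugeOrbit.posDefTr_deltaAY_parSymY_gaugeY_iff i hu _).mpr (h a ha)⟩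

/-- ★★★★ **… WITH THE CENTRE FROM PRINT's TWO STATEMENTS** (`m = B⁻¹` by module 82 §2 from Theorem 3.11's clause `PosDefTr 1 (Δ_a(U₀))` and Theorem 3.3's (3.46)–(3.47)
form bound `⟨Φ, G(U₀)Φ⟩₁ ≤ B⟨Φ,Φ⟩₁`, `0 < B`): for EVERY `U₀` in (3.35) at which print's two statements hold, `∃ R₁, 0 < R₁ ∧ R₁ ≤ R₁⋆ ∧ ∀ ‖A′‖ < R₁·B⁻¹∕(B⁻¹ + 2B′c_V),
PosDefTr 1 (Δ_a(e^{iηA′}U₀))` — Theorem 3.11's clause is OPEN along the pencil around every member of (3.35) where it holds together with Theorem 3.3, with a located radius.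
[cite: Balaban1985BackgroundPropagators, (3.19)–(3.27) pp.393–395, (3.34)–(3.35) p.396, Thm 3.1 (3.42) p.397, Thm 3.2 (3.48) p.398, (3.46)–(3.47) p.398, Thm 3.3 p.399, Thm 3.4 and (3.50) p.400, (3.62)–(3.64) p.402, (3.84) p.407, Thm 3.10 (3.107)–(3.108) pp.415–416, Thm 3.11 p.416; Balaban1984PropagatorsII, (2.19) and p.226, Lemma 2.1 (2.61) p.234; Balaban1988RG2Cluster, (2.5)–(2.7) pp.12–13, p.15] -/
theorem exists_ball_posDefTr_deltaAY_recordV4_prodCfg_of_reg335_of_posDefTr_of_GAY_formBound_located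
    (hG : G ≤ B7Prop2Explicit.unitaryUnits (Matrix (Fin N) (Fin N) ℂ))
    {U₀ : CfgY (Matrix (Fin N) (Fin N) ℂ) i} {c α₀ : ℝ} (hC0 : 0 ≤ c * (kGeo i).M * α₀) (hC1 : c * (kGeo i).M * α₀ * ((d : ℝ) + 1) ≤ 1 / 16)
    (hreg : (bg9K (Matrix (Fin N) (Fin N) ℂ) G i).Reg335 c α₀ U₀)
    (η : ℝ) {Rc : ℝ} (hRc : 0 < Rc) {ρ' : ℝ} (hρ'0 : 0 ≤ ρ')
    (hρ' : ρ' < (1 / (4 * ((d : ℝ) + 2))) * ((((d : ℝ) + 1) * ((((ℓ + 1) ^ i.k : ℕ) : ℝ)))⁻¹))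
    {μX : ℝ} (hμX : 0 < μX) (hμρ : μX < ρ')
    {κX : ℝ} (hκX : 0 ≤ κX) (hκ4X : κX ≤ (ρ' - μX) / 4)
    (hκmX : 8 * (Real.sqrt ((((ℓ : ℝ) + 1) ^ i.k) ^ (d + 1)) *
        (1 * (Fintype.card (Fin N × Fin N) : ℝ) *
            (1 * ((1 * Real.exp (|η| * Rc)) ^ ((d + 1) * ((ℓ + 1) ^ i.k - 1)) * 1 * (1 * Real.exp (|η| * Rc)) ^ ((d + 1) * ((ℓ + 1) ^ i.k - 1)))) *
          ((((ℓ : ℝ) + 1) ^ i.k) ^ (d + 1) * (Fintype.card (Fin N × Fin N) : ℝ) *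
            (1 * ((1 * Real.exp (|η| * Rc)) ^ ((d + 1) * ((ℓ + 1) ^ i.k - 1)) * 1 * (1 * Real.exp (|η| * Rc)) ^ ((d + 1) * ((ℓ + 1) ^ i.k - 1))))) *
          ((2 * (1 * 1 * (16 * ((((ℓ + 1) ^ i.k : ℕ) : ℝ)) ^ 2 * Real.sqrt N))) * (2 * (1 * 1 * (16 * ((((ℓ + 1) ^ i.k : ℕ) : ℝ)) ^ 2 * Real.sqrt N))) *
            (((N * N : ℕ) : ℝ) * B6.c0 1 μX ^ (d + 1))) *
          Real.exp (2 * (ρ' - μX) * (((d : ℝ) + 1) * (((((ℓ + 1) ^ i.k : ℕ) : ℝ)) - 1))))) * κX *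
        (((N * N : ℕ) : ℝ) * B6.c0 1 ((ρ' - μX) / 2) ^ (d + 1)) ≤
      ((4 * ((d : ℝ) + 1) + 1) ^ 2)⁻¹ * (ρ' - μX))
    {ρ'' : ℝ} (hρ''0 : 0 ≤ ρ'') (hρ'' : ρ'' < κX)
    {μ : ℝ} (hμ : 0 < μ) (h2μ : 2 * μ < ρ'')
    {B' : ℝ}
    (hBΔ : ∀ R : ℝ, 0 < R → R ≤ Rc →
      1 * (((4 * ((d : ℝ) + 1) * |i.cf|) * ((1 * Real.exp (|η| * R)) * ((1 * Real.exp (|η| * R)) ^ 4 * ((4 * |i.cf|) * ((1 * Real.exp (|η| * R)) * 1 * (1 * Real.exp (|η| * R))))) * (1 * Real.exp (|η| * R))) + 1 / 2 * ((4 * ((d : ℝ) + 1)) * ((1 * Real.exp (|η| * R)) * (2 * (i.cf ^ 2 * (1 * Real.exp (|η| * R)) ^ 4) * (8 * ((1 * Real.exp (|η| * R)) * 1 * (1 * Real.exp (|η| * R))))) * (1 * Real.exp (|η| * R))))) + 2 * ((1 * Real.exp (|η| * R)) ^ ((d + 2) * ((ℓ + 1) ^ i.k - 1)) * ((|b₁|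 * i.cf ^ 2 * ((((ℓ + 1 : ℕ) : ℝ)) ^ i.k) ^ (d + 1)) * (1 * ((1 * Real.exp (|η| * R)) ^ ((d + 2) * ((ℓ + 1) ^ i.k - 1)) * 1 * (1 * Real.exp (|η| * R)) ^ ((d + 2) * ((ℓ + 1) ^ i.k - 1))))) * (1 * Real.exp (|η| * R)) ^ ((d + 2) * ((ℓ + 1) ^ i.k - 1)))) * Real.exp ((ρ'' - 2 * μ) * (2 * (((d : ℝ) + 2) * ((((ℓ + 1) ^ i.k : ℕ) : ℝ) - 1)))) +
          (2 * |i.cf|) * (Fintype.card (Fin N × Fin N) : ℝ) * (1 * ((1 * Real.exp (|η| * R)) * 1 * (1 * Real.exp (|η| * R)))) * ((2 * |i.cf|) * (Fintype.card (Fin N × Fin N) : ℝ) * (1 * ((1 * Real.exp (|η| * R)) * 1 * (1 * Real.exp (|η| * R))))) * (1 + 2 * (1 * 1 * (16 * ((((ℓ + 1) ^ i.k : ℕ) : ℝ)) ^ 2 * Real.sqrt N)) *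
            (1 * (Fintype.card (Fin N × Fin N) : ℝ) *
                (1 * ((1 * Real.exp (|η| * R)) ^ ((d + 1) * ((ℓ + 1) ^ i.k - 1)) * 1 * (1 * Real.exp (|η| * R)) ^ ((d + 1) * ((ℓ + 1) ^ i.k - 1)))) *
              (1 * (Fintype.card (Fin N × Fin N) : ℝ) *
                (1 * ((1 * Real.exp (|η| * R)) ^ ((d + 1) * ((ℓ + 1) ^ i.k - 1)) * 1 * (1 * Real.exp (|η| * R)) ^ ((d + 1) * ((ℓ + 1) ^ i.k - 1))))) *
              (2 * (1 * 1 * ((N : ℝ) ^ 3 * (Real.sqrt ((((ℓ : ℝ) + 1) ^ i.k) ^ (d + 1)) * (4 / ((4 * ((d : ℝ) + 1) + 1) ^ 2)⁻¹))))) *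
              Real.exp (2 * ρ'' * (((d : ℝ) + 1) * ((((ℓ + 1) ^ i.k : ℕ) : ℝ) - 1))) * (2 * (1 * 1 * (16 * ((((ℓ + 1) ^ i.k : ℕ) : ℝ)) ^ 2 * Real.sqrt N))) *
              (((N * N : ℕ) : ℝ) * B6.c0 1 μ ^ (d + 1))) *
            (((N * N : ℕ) : ℝ) * B6.c0 1 μ ^ (d + 1))) * Real.exp (2 * (ρ'' - 2 * μ) * 1) ≤ B')
    -- print's two statements at the centre: Theorem 3.11's clause (row 17) and Theorem 3.3's (3.46)–(3.47) for `G`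
    (hpd : PosDefTr (fun _ => (1 : ℝ)) (deltaAY i (parSymY i) (parBY i) (GpY i (parSymY i)) U₀))
    {B : ℝ} (hB : 0 < B)
    (hGB : ∀ Φ : FBondY i → Matrix (Fin N) (Fin N) ℂ,
      trIP (fun _ => (1 : ℝ)) Φ (GAY i (parSymY i) (parBY i) (GpY i (parSymY i)) U₀ Φ) ≤ B * trIP (fun _ => (1 : ℝ)) Φ Φ) :
    ∃ R₁ : ℝ, 0 < R₁ ∧ R₁ ≤ Rc / (4 * ((1 * (((d : ℝ) + 1) * (1 * Real.exp (|η| * Rc) * (1 * Real.exp (|η| * Rc) * 1 * (1 * Real.exp (|η| * Rc)) + 1) * (1 * Real.exp (|η| * Rc)) +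
            (1 * Real.exp (|η| * Rc) * 1 * (1 * Real.exp (|η| * Rc)) + 1)) + 1 * ((1 * Real.exp (|η| * Rc)) ^ (2 * (d + 1) * ((ℓ + 1) ^ i.k - 1)) * 1 * (1 * Real.exp (|η| * Rc)) ^ (2 * (d + 1) * ((ℓ + 1) ^ i.k - 1)))) *
            Real.exp ((1 / (4 * ((d : ℝ) + 2)) * ((((d : ℝ) + 1) * ((((ℓ + 1) ^ i.k : ℕ) : ℝ)))⁻¹)) * (((d : ℝ) + 1) * ((((ℓ + 1) ^ i.k : ℕ) : ℝ))))) * (1 * 1 * (16 * ((((ℓ + 1) ^ i.k : ℕ) : ℝ)) ^ 2 * Real.sqrt N)) *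
          (((N * N : ℕ) : ℝ) * B6.c0 1 (((1 / (4 * ((d : ℝ) + 2))) * ((((d : ℝ) + 1) * ((((ℓ + 1) ^ i.k : ℕ) : ℝ)))⁻¹) - ρ') / 3) ^ (d + 1)) *
          (((N * N : ℕ) : ℝ) * B6.c0 1 (((1 / (4 * ((d : ℝ) + 2))) * ((((d : ℝ) + 1) * ((((ℓ + 1) ^ i.k : ℕ) : ℝ)))⁻¹) - ρ') / 3) ^ (d + 1))) + 1) ∧
  ∀ a ∈ ball (0 : Fin (d + 1) → Site (PV d ℓ i.m i.K hd hL) 0 → Matrix (Fin N) (Fin N) ℂ) (R₁ * (B⁻¹ / (B⁻¹ + 2 * (B' * ((((d + 1) * (N * N) : ℕ) : ℝ) * B6.c0 1 (ρ'' - 2 * μ) ^ (d + 1)))))),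
      PosDefTr (fun _ => (1 : ℝ)) (deltaAY i (parSymY i) (parBY i) (GpY i (parSymY i)) (prodCfg U₀ η a)) :=
  exists_ball_posDefTr_deltaAY_recordV4_prodCfg_of_reg335_of_coer_centre_located i hG hC0 hC1 hreg η hRc hρ'0 hρ' hμX hμρ hκX hκ4X hκmX hρ''0 hρ'' hμ h2μ hBΔ
    (inv_pos.mpr hB) (trIP_deltaAY_parSymY_ge_of_posDefTr_of_GAY_formBound i hG hreg.1 hpd hB hGB)

end Literature.MathematicalPhysics.QuantumFieldTheory.Balaban1983to89.B13CoerciveAlongPencilReg335Located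

end
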